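import Summits.ResolutionOfSingularities.ResolutionOfSingularities.Theorems.FrobeniusClosingSteerCore4DictionaryRun
import Summits.ResolutionOfSingularities.ResolutionOfSingularities.Theorems.WildConesIsolatedForcedTermination
import Literature.AlgebraicGeometry.Resolution.QuadraticTransformsRegular
import Mathlib.RingTheory.LocalRing.ResidueField.Basic
import Mathlib.FieldTheory.IsAlgClosed.AlgebraicClosure
import HarnessLib
/-!
# Crux `Steer` (stmt-ResolutionOfSingularities-16345), line `switching_dichotomy` r9 — the LEAF of `stub_core4Dictionary`,
# CONDITIONAL on the four Theses-free dictionary helpers T1/T2/I/S (chain W4.1, lead res-L0-w41-lead-1) — part 2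

OURS (campaign res-hironaka, rung L, slot W4.1; replaces the role of no printed item; NOT a statement of the
manuscript; AI-written, weaker than expert review). `stub_core4Dictionary` (skeleton r9, sha 24abaaa5): along a
zero-dimensional valuation ring `O` over a PERFECT field, over a base regular at the centre, an ETERNAL torsor run
(strict transforms `s i = x · s (i+1) + g` of a generator of `T^p = t^p` along the quadratic sequence `R` of the
base at the centres of `O`) is NON-ISOLATED infinitely often — the one place where the antecedent
`IsolatedForcedTermination` of `Steer` (a theorem, p459384) is CONSUMED. `stub_core4Dictionary_of_dict` proves it
(the `Sig` inlined verbatim) from FOUR hypotheses quoted verbatim from the lead's `DICT-SIGS.lean` v3: T1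
`chart_zero` (Cohen chart of a dominated regular local `R ⊆ O`: `φ : R →+* κ⟦X⟧` with constant coefficients =
residues (FC1) and the centre generating `(X)` (FC2)), T2 `chart_step` (a chart propagates along one quadratic
transform at a possibly NON-rational centre, transition = `Φ_{j,τ}`, exceptional parameter ↦ `X_j · unit`), I
`isol_transfer` (`𝔪^N ⊆ (δ f)` ⇒ `(X)^N ⊆ (∂ φf)`), S (`X_j^e ∣ Φ_{j,τ}(H) ⇒ e ≤ ord H`). Proved HERE: the chain
of charts along the sequence (`exists_charts`, `Nat.rec` over T1/T2), the typed field `κ = (ResidueField O)^alg`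
with the image of `k` perfect and `κ` algebraic over it and perfect residue fields of the `R i` (both from
`ZeroDim`), the radicand relation by Frobenius, the passage from the elementwise `IsolAt` to a power of the
centre, and the contradiction with `IsolatedForcedTermination_proof` via part 1
(`FrobeniusClosingSteerCore4DictionaryRun.infRun_of_charts`). [cite: Matsumura1987, Thms. 28.3, 29.7]
[cite: arXiv:1802.05010, §§2–3]
-/

noncomputable section

-- single-problem summit: the doubled namespace component `ResolutionOfSingularities` is forced by the tree layout
set_option linter.dupNamespace false

open Classical
open Literature.AlgebraicGeometry.Resolution
open MvPowerSeries IsLocalRing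
open Summit.ResolutionOfSingularities.ResolutionOfSingularities.Theorems.WildCones

namespace Summit.ResolutionOfSingularities.ResolutionOfSingularities.Theorems.SwitchingDichotomy.Core4Dictionary

variable {K : Type} [Field K]

/-- `IsolatedForcedTermination` (the `let`-calculus of route `FrobeniusClosing`) IS «no `InfRun`» for the named
dynamics of `Theorems.WildCones` (definitional). -/
theorem not_infRun (hT : Theses.FrobeniusClosing.IsolatedForcedTermination) (p : ℕ) (hp : p.Prime) (n : ℕ)
    (hn : 0 < n) (κ : Type) [Field κ] [CharP κ p] [PerfectField κ] (c₀ : (Fin n → ℕ) → κ)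
    (i : ℕ → Fin n) (t : ℕ → Fin n → κ) : ¬ InfRun p n κ c₀ i t :=
  hT p hp n hn κ c₀ i t

section Algebraic

variable (O : ValuationSubring K)

/-- An exceptional parameter `x` of `R` (maximal value in the centre) divides every element of the
centre inside the quadratic transform `R₁` of `R` along `O`. -/
theorem div_mem_of_excParam {R R₁ : Subring K} (hQ : IsQuadraticTransformAlong O R R₁)
    (hdom : SubringDominates R O.toSubring) {x : K} (hxR : x ∈ R) (hx0 : x ≠ 0)
    (hvx : O.valuation x < 1)
    (hmax : ∀ y ∈ R, O.valuation y < 1 → O.valuation y ≤ O.valuation x)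
    {y : K} (hy : y ∈ R) (hvy : O.valuation y < 1) : y / x ∈ R₁ := by
  obtain ⟨_, x', hx'm, hx'0, hmin', rfl⟩ := hQ.exists_eq_locAtCentre
  have hRO : R ≤ O.toSubring := hdom.1
  have hdom' := (subringDominates_valuationSubring_iff hRO).mp hdom
  have hxm : (⟨x, hxR⟩ : R) ∈ maximalIdeal R := (hdom' ⟨x, hxR⟩).mpr hvx
  have hym : (⟨y, hy⟩ : R) ∈ maximalIdeal R := (hdom' ⟨y, hy⟩).mpr hvy
  have hx'0K : ((x' : R) : K) ≠ 0 := fun e => hx'0 (Subtype.ext e)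
  have hv : O.valuation x = O.valuation ((x' : R) : K) :=
    le_antisymm (hmin' ⟨x, hxR⟩ hxm) (hmax _ x'.2 ((hdom' x').mp hx'm))
  have h1 : O.valuation (x / ((x' : R) : K)) = 1 := by
    rw [map_div₀, hv, div_self ((map_ne_zero _).mpr hx'0K)]
  refine (mem_locAtCentre_iff).mpr ⟨y / ((x' : R) : K), div_mem_blowupRing _ hym,
    x / ((x' : R) : K), div_mem_blowupRing _ hxm, h1, ?_⟩
  field_simp

/-- The centre of `O` on a dominated member is its maximal ideal. [folklore] -/
theorem centre_eq_maximalIdeal {R : Subring K} [IsLocalRing R] (hdom : SubringDominates R O.toSubring) :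
    Ideal.comap (Subring.inclusion hdom.1) (maximalIdeal O) = maximalIdeal R := by
  ext y
  rw [Ideal.mem_comap, ValuationSubring.valuation_lt_one_iff,
    (subringDominates_valuationSubring_iff hdom.1).mp hdom y]
  rfl

end Algebraic

section Charts

variable (O : ValuationSubring K) {κ : Type} [Field κ] (ι : ResidueField O →+* κ)

/-- **Formal charts along the quadratic sequence**: starting at stage `i₀` (T1) and propagating (T2). -/
theorem exists_charts
    (hT1 : (∀ {K : Type} [Field K] (O : ValuationSubring K) {κ : Type} [Field κ] (ι : ResidueField O →+* κ)
      (p : ℕ) [Fact p.Prime] [CharP K p] (R : Subring K) (hR : R ≤ O.toSubring)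
      [IsRegularLocalRing R], SubringDominates R O.toSubring → ∀ (d : ℕ),
      (maximalIdeal R).spanFinrank = d →
      ∃ φ : R →+* MvPowerSeries (Fin d) κ,
        (∀ r : R, constantCoeff (φ r) = ι (residue O (Subring.inclusion hR r))) ∧
        Ideal.map φ (Ideal.comap (Subring.inclusion hR) (maximalIdeal O)) =
          Ideal.span (Set.range (X : Fin d → MvPowerSeries (Fin d) κ))))
    (hT2 : (∀ {K : Type} [Field K] (O : ValuationSubring K) {κ : Type} [Field κ] (ι : ResidueField O →+* κ)
      (k₀ : Subfield κ) [PerfectField k₀], Algebra.IsAlgebraic k₀ κ →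
      ∀ (R R₁ : Subring K) (hR : R ≤ O.toSubring) (hR₁ : R₁ ≤ O.toSubring)
      [IsRegularLocalRing R], SubringDominates R O.toSubring → (hQ : IsQuadraticTransformAlong O R R₁) →
      (∀ a ∈ k₀, ∃ r : R, ι (residue O (Subring.inclusion hR r)) = a) →
      ∀ (d : ℕ), (maximalIdeal R).spanFinrank = d → ∀ (φ : R →+* MvPowerSeries (Fin d) κ),
      (∀ r : R, constantCoeff (φ r) = ι (residue O (Subring.inclusion hR r))) →
      Ideal.map φ (Ideal.comap (Subring.inclusion hR) (maximalIdeal O)) =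
        Ideal.span (Set.range (X : Fin d → MvPowerSeries (Fin d) κ)) →
      ∀ (x : K), x ≠ 0 → ∀ (hxR : x ∈ R), O.valuation x < 1 →
      (∀ y ∈ R, O.valuation y < 1 → y / x ∈ R₁) →
      ∃ (j : Fin d) (τ : Fin d → κ) (φ₁ : R₁ →+* MvPowerSeries (Fin d) κ),
        (∀ r : R₁, constantCoeff (φ₁ r) = ι (residue O (Subring.inclusion hR₁ r))) ∧
        Ideal.map φ₁ (Ideal.comap (Subring.inclusion hR₁) (maximalIdeal O)) =
          Ideal.span (Set.range (X : Fin d → MvPowerSeries (Fin d) κ)) ∧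
        (∀ r : R, φ₁ (Subring.inclusion hQ.le r) =
          subst (fun s : Fin d => if s = j then (X j : MvPowerSeries (Fin d) κ) else X j * (X s + C (τ s)))
            (φ r)) ∧
        (∃ w : MvPowerSeries (Fin d) κ, IsUnit w ∧ φ₁ ⟨x, hQ.le hxR⟩ = X j * w) ∧
        (Ideal.comap (Subring.inclusion hR₁) (maximalIdeal O)).spanFinrank = d))
    (p : ℕ) [Fact p.Prime] [CharP K p]
    (k₀ : Subfield κ) [PerfectField k₀] (halg : Algebra.IsAlgebraic k₀ κ)
    (R : ℕ → Subring K) (hRO : ∀ i, R i ≤ O.toSubring) (hreg : ∀ i, IsRegularLocalRing (R i))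
    (hdom : ∀ i, SubringDominates (R i) O.toSubring)
    (hq : ∀ i, IsQuadraticTransformAlong O (R i) (R (i + 1)))
    (hk₀ : ∀ i, ∀ a ∈ k₀, ∃ r : R i, ι (residue O (Subring.inclusion (hRO i) r)) = a)
    (x : ℕ → K) (hx0 : ∀ i, x i ≠ 0) (hxR : ∀ i, x i ∈ R i) (hxv : ∀ i, O.valuation (x i) < 1)
    (hdiv : ∀ i, ∀ y ∈ R i, O.valuation y < 1 → y / x i ∈ R (i + 1))
    (i₀ d : ℕ) (hd : (@maximalIdeal (R i₀) _ (hreg i₀).toIsLocalRing).spanFinrank = d) :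
    ∃ (φ : (m : ℕ) → (R (i₀ + m) →+* MvPowerSeries (Fin d) κ)) (j : ℕ → Fin d)
      (τ : ℕ → Fin d → κ) (w : ℕ → MvPowerSeries (Fin d) κ),
      ∀ m, (∀ r : R (i₀ + m), constantCoeff (φ m r) = ι (residue O (Subring.inclusion (hRO (i₀ + m)) r))) ∧
        Ideal.map (φ m) (Ideal.comap (Subring.inclusion (hRO (i₀ + m))) (maximalIdeal O)) =
          Ideal.span (Set.range (X : Fin d → MvPowerSeries (Fin d) κ)) ∧
        (@maximalIdeal (R (i₀ + m)) _ (hreg _).toIsLocalRing).spanFinrank = d ∧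
        (∀ r : R (i₀ + m), φ (m + 1) (Subring.inclusion (hq (i₀ + m)).le r) = subst (fun s : Fin d => if s = (j m) then (X (j m) : MvPowerSeries (Fin d) κ) else X (j m) * (X s + C ((τ m) s))) (φ m r)) ∧
        IsUnit (w m) ∧ φ (m + 1) ⟨x (i₀ + m), (hq _).le (hxR _)⟩ = X (j m) * w m := by
  classical
  have hcm : ∀ i, Ideal.comap (Subring.inclusion (hRO i)) (maximalIdeal O) =
      @maximalIdeal (R i) _ (hreg i).toIsLocalRing := fun i => by
    haveI := hreg i
    exact centre_eq_maximalIdeal O (hdom i)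
  let CT : ℕ → Type := fun m => {φ : R (i₀ + m) →+* MvPowerSeries (Fin d) κ //
      (∀ r : R (i₀ + m), constantCoeff (φ r) = ι (residue O (Subring.inclusion (hRO (i₀ + m)) r))) ∧
      Ideal.map φ (Ideal.comap (Subring.inclusion (hRO (i₀ + m))) (maximalIdeal O)) =
        Ideal.span (Set.range (X : Fin d → MvPowerSeries (Fin d) κ)) ∧
      (@maximalIdeal (R (i₀ + m)) _ (hreg _).toIsLocalRing).spanFinrank = d}
  have hbase : ∃ φ : R (i₀ + 0) →+* MvPowerSeries (Fin d) κ,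
      (∀ r : R (i₀ + 0), constantCoeff (φ r) = ι (residue O (Subring.inclusion (hRO (i₀ + 0)) r))) ∧
      Ideal.map φ (Ideal.comap (Subring.inclusion (hRO (i₀ + 0))) (maximalIdeal O)) =
        Ideal.span (Set.range (X : Fin d → MvPowerSeries (Fin d) κ)) := by
    haveI := hreg (i₀ + 0)
    exact hT1 O ι p (R (i₀ + 0)) (hRO _) (hdom _) d hd
  let base : CT 0 := ⟨hbase.choose, hbase.choose_spec.1, hbase.choose_spec.2, hd⟩
  have stepE : ∀ (m : ℕ) (ch : CT m), ∃ (j : Fin d) (τ : Fin d → κ)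
      (φ₁ : R (i₀ + m + 1) →+* MvPowerSeries (Fin d) κ),
      (∀ r : R (i₀ + m + 1), constantCoeff (φ₁ r) = ι (residue O (Subring.inclusion (hRO (i₀ + m + 1)) r))) ∧
      Ideal.map φ₁ (Ideal.comap (Subring.inclusion (hRO (i₀ + m + 1))) (maximalIdeal O)) =
        Ideal.span (Set.range (X : Fin d → MvPowerSeries (Fin d) κ)) ∧
      (∀ r : R (i₀ + m), φ₁ (Subring.inclusion (hq (i₀ + m)).le r) = subst (fun s : Fin d => if s = j then (X j : MvPowerSeries (Fin d) κ) else X j * (X s + C (τ s))) (ch.1 r)) ∧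
      (∃ w : MvPowerSeries (Fin d) κ, IsUnit w ∧ φ₁ ⟨x (i₀ + m), (hq _).le (hxR _)⟩ = X j * w) ∧
      (Ideal.comap (Subring.inclusion (hRO (i₀ + m + 1))) (maximalIdeal O)).spanFinrank = d := fun m ch => by
    haveI := hreg (i₀ + m)
    exact hT2 O ι k₀ halg (R (i₀ + m)) (R (i₀ + m + 1)) (hRO _) (hRO _) (hdom _) (hq _) (hk₀ _) d
      ch.2.2.2 ch.1 ch.2.1 ch.2.2.1 (x (i₀ + m)) (hx0 _) (hxR _) (hxv _) (hdiv _)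
  let next : ∀ m, CT m → CT (m + 1) := fun m ch =>
    ⟨(stepE m ch).choose_spec.choose_spec.choose,
     (stepE m ch).choose_spec.choose_spec.choose_spec.1,
     (stepE m ch).choose_spec.choose_spec.choose_spec.2.1,
     by rw [← hcm]; exact (stepE m ch).choose_spec.choose_spec.choose_spec.2.2.2.2⟩
  let charts : ∀ m, CT m := fun m => Nat.rec (motive := CT) base next m
  have hsucc : ∀ m, charts (m + 1) = next m (charts m) := fun m => rfl
  refine ⟨fun m => (charts m).1, fun m => (stepE m (charts m)).choose,
    fun m => (stepE m (charts m)).choose_spec.choose,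
    fun m => (stepE m (charts m)).choose_spec.choose_spec.choose_spec.2.2.2.1.choose, fun m => ?_⟩
  refine ⟨(charts m).2.1, (charts m).2.2.1, (charts m).2.2.2, ?_, ?_, ?_⟩
  · intro r
    show (charts (m + 1)).1 _ = subst (fun s : Fin d => if s = (stepE m (charts m)).choose then (X (stepE m (charts m)).choose : MvPowerSeries (Fin d) κ) else X (stepE m (charts m)).choose * (X s + C ((stepE m (charts m)).choose_spec.choose s))) ((charts m).1 r)
    rw [hsucc]
    exact (stepE m (charts m)).choose_spec.choose_spec.choose_spec.2.2.1 r
  · exact (stepE m (charts m)).choose_spec.choose_spec.choose_spec.2.2.2.1.choose_spec.1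
  · show (charts (m + 1)).1 _ = X (stepE m (charts m)).choose *
      (stepE m (charts m)).choose_spec.choose_spec.choose_spec.2.2.2.1.choose
    rw [hsucc]
    exact (stepE m (charts m)).choose_spec.choose_spec.choose_spec.2.2.2.1.choose_spec.2

end Charts

section Residue

variable {k : Type} [Field k] (O : ValuationSubring K)

/-- Residues of a local subring `S ⊆ O` whose maximal ideal is the centre are algebraic over `k`, when
every element of `O` is a root modulo `𝔪_O` of a non-zero polynomial over `k` (`ZeroDim`). -/
theorem exists_eval₂_residue_eq_zero [Algebra k K]
    (hzd : ∀ x ∈ O, ∃ f : Polynomial k, f ≠ 0 ∧ Polynomial.aeval (R := k) x f ∈ O.nonunits)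
    {S : Type} [CommRing S] [IsLocalRing S] (sub : S →+* K) (hSO : ∀ y : S, sub y ∈ O)
    (hmax : ∀ y : S, O.valuation (sub y) < 1 → y ∈ maximalIdeal S) (kS : k →+* S)
    (hkS : ∀ c, sub (kS c) = algebraMap k K c) (z : ResidueField S) :
    ∃ f : Polynomial k, f ≠ 0 ∧ Polynomial.eval₂ ((residue S).comp kS) z f = 0 := by
  obtain ⟨y, rfl⟩ := IsLocalRing.residue_surjective z
  obtain ⟨f, hf0, hf⟩ := hzd (sub y) (hSO y)
  refine ⟨f, hf0, ?_⟩
  have h1 : Polynomial.eval₂ ((residue S).comp kS) (residue S y) f = residue S (Polynomial.eval₂ kS y f) :=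
    (Polynomial.hom_eval₂ f kS (residue S) y).symm
  have h2 : sub (Polynomial.eval₂ kS y f) = Polynomial.aeval (R := k) (sub y) f := by
    rw [Polynomial.aeval_def, Polynomial.hom_eval₂ f kS sub y]
    congr 1
    ext c
    exact hkS c
  rw [h1, IsLocalRing.residue_eq_zero_iff]
  apply hmax
  rw [h2]
  exact (ValuationSubring.mem_nonunits_iff O).mp hf

end Residue

section Leaf

open Literature.RingTheory.MvPowerSeries.Jets

/-- **`Sig.stub_core4Dictionary` (r9, inlined verbatim) from the dictionary helpers T1/T2/I and the
blow-up order lemma S.** -/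
theorem stub_core4Dictionary_of_dict
    (hT1 : (∀ {K : Type} [Field K] (O : ValuationSubring K) {κ : Type} [Field κ] (ι : ResidueField O →+* κ)
      (p : ℕ) [Fact p.Prime] [CharP K p] (R : Subring K) (hR : R ≤ O.toSubring)
      [IsRegularLocalRing R], SubringDominates R O.toSubring → ∀ (d : ℕ),
      (maximalIdeal R).spanFinrank = d →
      ∃ φ : R →+* MvPowerSeries (Fin d) κ,
        (∀ r : R, constantCoeff (φ r) = ι (residue O (Subring.inclusion hR r))) ∧
        Ideal.map φ (Ideal.comap (Subring.inclusion hR) (maximalIdeal O)) =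
          Ideal.span (Set.range (X : Fin d → MvPowerSeries (Fin d) κ))))
    (hT2 : (∀ {K : Type} [Field K] (O : ValuationSubring K) {κ : Type} [Field κ] (ι : ResidueField O →+* κ)
      (k₀ : Subfield κ) [PerfectField k₀], Algebra.IsAlgebraic k₀ κ →
      ∀ (R R₁ : Subring K) (hR : R ≤ O.toSubring) (hR₁ : R₁ ≤ O.toSubring)
      [IsRegularLocalRing R], SubringDominates R O.toSubring → (hQ : IsQuadraticTransformAlong O R R₁) →
      (∀ a ∈ k₀, ∃ r : R, ι (residue O (Subring.inclusion hR r)) = a) →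
      ∀ (d : ℕ), (maximalIdeal R).spanFinrank = d → ∀ (φ : R →+* MvPowerSeries (Fin d) κ),
      (∀ r : R, constantCoeff (φ r) = ι (residue O (Subring.inclusion hR r))) →
      Ideal.map φ (Ideal.comap (Subring.inclusion hR) (maximalIdeal O)) =
        Ideal.span (Set.range (X : Fin d → MvPowerSeries (Fin d) κ)) →
      ∀ (x : K), x ≠ 0 → ∀ (hxR : x ∈ R), O.valuation x < 1 →
      (∀ y ∈ R, O.valuation y < 1 → y / x ∈ R₁) →
      ∃ (j : Fin d) (τ : Fin d → κ) (φ₁ : R₁ →+* MvPowerSeries (Fin d) κ),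
        (∀ r : R₁, constantCoeff (φ₁ r) = ι (residue O (Subring.inclusion hR₁ r))) ∧
        Ideal.map φ₁ (Ideal.comap (Subring.inclusion hR₁) (maximalIdeal O)) =
          Ideal.span (Set.range (X : Fin d → MvPowerSeries (Fin d) κ)) ∧
        (∀ r : R, φ₁ (Subring.inclusion hQ.le r) =
          subst (fun s : Fin d => if s = j then (X j : MvPowerSeries (Fin d) κ) else X j * (X s + C (τ s)))
            (φ r)) ∧
        (∃ w : MvPowerSeries (Fin d) κ, IsUnit w ∧ φ₁ ⟨x, hQ.le hxR⟩ = X j * w) ∧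
        (Ideal.comap (Subring.inclusion hR₁) (maximalIdeal O)).spanFinrank = d))
    (hI : (∀ {K : Type} [Field K] (O : ValuationSubring K) {κ : Type} [Field κ]
      (p : ℕ) [Fact p.Prime] [CharP K p] [CharP κ p] [PerfectField κ]
      (R : Subring K) (hR : R ≤ O.toSubring) [IsRegularLocalRing R], SubringDominates R O.toSubring →
      PerfectField (ResidueField R) →
      ∀ (d : ℕ), (maximalIdeal R).spanFinrank = d → ∀ (φ : R →+* MvPowerSeries (Fin d) κ),
      Ideal.map φ (Ideal.comap (Subring.inclusion hR) (maximalIdeal O)) =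
        Ideal.span (Set.range (X : Fin d → MvPowerSeries (Fin d) κ)) → ∀ (f : R) (N : ℕ),
      Ideal.comap (Subring.inclusion hR) (maximalIdeal O) ^ N ≤
        Ideal.span (Set.range fun δ : Derivation ℤ R R => δ f) →
      Ideal.span (Set.range (X : Fin d → MvPowerSeries (Fin d) κ)) ^ N ≤
        Ideal.span (Set.range fun l : Fin d => MvPowerSeries.pderiv l (φ f))))
    (hS : (∀ {κ : Type} [Field κ] {d : ℕ} (j : Fin d) (τ : Fin d → κ) (H : MvPowerSeries (Fin d) κ) (e : ℕ),
      X j ^ e ∣ subst (fun s : Fin d => if s = j then (X j : MvPowerSeries (Fin d) κ) else X j * (X s + C (τ s))) H →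
      (e : ℕ∞) ≤ H.order)) :
    Theses.FrobeniusClosing.IsolatedForcedTermination → ∀ p : ℕ, p.Prime →
    ∀ (k K : Type) [Field k] [CharP k p] [PerfectField k] [Field K] [Algebra k K]
    (O : ValuationSubring K) (A₀ : Subalgebra k K) (h₀ : A₀.toSubring ≤ O.toSubring) (t : K),
    A₀.FG → t ^ p ∈ A₀ → IsFractionRing (Algebra.adjoin k (insert t (A₀ : Set K))) K →
    IsRegularLocalRing (Localization.AtPrime
      (Ideal.comap (Subring.inclusion h₀) (IsLocalRing.maximalIdeal O))) →
    (∀ x ∈ O, ∃ f : Polynomial k, f ≠ 0 ∧ Polynomial.aeval x f ∈ O.nonunits) →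
    ∀ R : ℕ → Subring K, R 0 = locAtCentre A₀.toSubring O →
      (∀ i, IsQuadraticTransformAlong O (R i) (R (i + 1))) →
      ∀ s : ℕ → K, (s 0 = t ∧ (∀ i, s i ^ p ∈ R i) ∧
          ∀ i, ∃ x g : K, (x ∈ R i ∧ x ≠ 0 ∧ O.valuation x < 1 ∧
            ∀ y ∈ R i, O.valuation y < 1 → O.valuation y ≤ O.valuation x) ∧
            g ∈ R i ∧ s i = x * s (i + 1) + g) →
      ∀ i₀ : ℕ, ∃ i, i₀ ≤ i ∧ ¬ (∃ (hf : s i ^ p ∈ R i) (N : ℕ), ∀ y : R i,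
          O.valuation (y : K) < 1 →
          y ^ N ∈ Ideal.span (Set.range fun δ : Derivation ℤ (R i) (R i) => δ ⟨s i ^ p, hf⟩)) := by
  intro hT p hp k K _ _ _ _ _ O A₀ h₀ t hfg htp hfr hreg hzd R hR0 hq s hs i₀
  obtain ⟨hs0, hsp, hstep⟩ := hs
  by_contra hcon
  push Not at hcon
  haveI hpF : Fact p.Prime := ⟨hp⟩
  haveI : CharP K p := charP_of_injective_algebraMap (algebraMap k K).injective p
  -- the quadratic sequence: regular, dominated
  have hreg0 : IsRegularLocalRing (R 0) := by
    rw [hR0]; exact (isRegularLocalRing_locAtCentre_iff h₀).mpr hreg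
  have hregi : ∀ i, IsRegularLocalRing (R i) := isRegularLocalRing_sequence hreg0 hq
  have hdom0 : SubringDominates (R 0) O.toSubring := by rw [hR0]; exact subringDominates_locAtCentre h₀
  have hdomi : ∀ i, SubringDominates (R i) O.toSubring := fun i => (sequence_dominates hdom0 hq i).1
  have hRO : ∀ i, R i ≤ O.toSubring := fun i => (hdomi i).1
  have hmono : ∀ i, R 0 ≤ R i := fun i => by
    induction i with
    | zero => exact le_rfl
    | succ i ih => exact ih.trans (hq i).le
  have hmax : ∀ i (y : R i), O.valuation (y : K) < 1 → y ∈ @maximalIdeal (R i) _ (hregi i).toIsLocalRing :=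
    fun i y hy => by
      haveI := hregi i
      exact ((subringDominates_valuationSubring_iff (hRO i)).mp (hdomi i) y).mpr hy
  -- exceptional parameters and cleaners
  choose x g hx hg hsx using hstep
  have hdiv : ∀ i, ∀ y ∈ R i, O.valuation y < 1 → y / x i ∈ R (i + 1) := fun i y hy hvy =>
    div_mem_of_excParam O (hq i) (hdomi i) (hx i).1 (hx i).2.1 (hx i).2.2.1 (hx i).2.2.2 hy hvy
  -- the typed field: an algebraic closure of the residue field of `O`
  let kO : k →+* O := (algebraMap k K).codRestrict O (fun a => h₀ (A₀.algebraMap_mem a))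
  letI algkO : Algebra k (ResidueField O) := ((residue O).comp kO).toAlgebra
  let κ : Type := AlgebraicClosure (ResidueField O)
  let ι : ResidueField O →+* κ := algebraMap (ResidueField O) κ
  haveI : CharP (ResidueField O) p := charP_of_injective_ringHom ((residue O).comp kO).injective p
  haveI : CharP κ p := charP_of_injective_ringHom ι.injective p
  let kκ : k →+* κ := algebraMap k κ
  have hkκ : ∀ c, kκ c = ι (residue O (kO c)) := fun c => IsScalarTower.algebraMap_apply k (ResidueField O) κ c
  let k₀ : Subfield κ := kκ.fieldRange
  haveI : PerfectField k₀ := PerfectField.of_ringEquiv (RingHom.rangeRestrictFieldEquiv kκ)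
  -- `κ` is algebraic over `k₀`
  have halg : Algebra.IsAlgebraic k₀ κ := by
    haveI : Algebra.IsAlgebraic k (ResidueField O) := by
      refine ⟨fun z => ?_⟩
      obtain ⟨f, hf0, hf⟩ := exists_eval₂_residue_eq_zero O hzd O.subtype (fun y => y.2)
        (fun y hy => (ValuationSubring.valuation_lt_one_iff O y).mpr hy) kO (fun c => rfl) z
      exact ⟨f, hf0, hf⟩
    haveI : Algebra.IsAlgebraic k κ := Algebra.IsAlgebraic.trans k (ResidueField O) κ
    letI : Algebra k k₀ := (RingHom.rangeRestrictField kκ).toAlgebra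
    haveI : IsScalarTower k k₀ κ :=
      IsScalarTower.of_algebraMap_eq (fun c => (RingHom.coe_rangeRestrictField kκ c).symm)
    exact Algebra.IsAlgebraic.tower_top (K := k) k₀
  have hkR : ∀ i (c : k), algebraMap k K c ∈ R i := fun i c =>
    hmono i (by rw [hR0]; exact le_locAtCentre _ O (A₀.algebraMap_mem c))
  have hk₀ : ∀ i, ∀ a ∈ k₀, ∃ r : R i, ι (residue O (Subring.inclusion (hRO i) r)) = a := by
    intro i a ha
    obtain ⟨c, rfl⟩ := RingHom.mem_fieldRange.mp ha
    refine ⟨⟨algebraMap k K c, hkR i c⟩, ?_⟩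
    have : Subring.inclusion (hRO i) ⟨algebraMap k K c, hkR i c⟩ = kO c := Subtype.ext rfl
    rw [this, hkκ]
  -- residue fields of the members are perfect
  have hperf : ∀ i, @PerfectField (@ResidueField (R i) _ (hregi i).toIsLocalRing)
      (@IsLocalRing.ResidueField.field (R i) _ (hregi i).toIsLocalRing) := by
    intro i
    haveI := hregi i
    let kR : k →+* R i := (algebraMap k K).codRestrict (R i) (hkR i)
    letI : Algebra k (ResidueField (R i)) := ((residue (R i)).comp kR).toAlgebra
    haveI : Algebra.IsAlgebraic k (ResidueField (R i)) := by
      refine ⟨fun z => ?_⟩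
      obtain ⟨f, hf0, hf⟩ := exists_eval₂_residue_eq_zero O hzd (R i).subtype (fun y => hRO i y.2)
        (hmax i) kR (fun c => rfl) z
      exact ⟨f, hf0, hf⟩
    exact Algebra.IsAlgebraic.perfectField k
  -- the number of variables
  haveI := hregi i₀
  set d : ℕ := (maximalIdeal (R i₀)).spanFinrank with hd
  have hd0 : 0 < d := by
    rw [hd, Nat.pos_iff_ne_zero, Ne, Submodule.spanFinrank_eq_zero_iff_eq_bot
      (IsNoetherian.noetherian _)]
    intro hbot
    have hxm : (⟨x i₀, (hx i₀).1⟩ : R i₀) ∈ maximalIdeal (R i₀) := hmax i₀ _ (hx i₀).2.2.1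
    rw [hbot, Ideal.mem_bot] at hxm
    exact (hx i₀).2.1 (congrArg Subtype.val hxm)
  -- the chain of charts
  obtain ⟨φ, j, τ, w, hch⟩ := exists_charts O ι hT1 hT2 p k₀ halg R hRO hregi hdomi hq hk₀ x
    (fun i => (hx i).2.1) (fun i => (hx i).1) (fun i => (hx i).2.2.1) hdiv i₀ d hd.symm
  -- the typed run is an `InfRun`
  have hrel : ∀ m, s (i₀ + m + 1) ^ p * x (i₀ + m) ^ p = s (i₀ + m) ^ p - g (i₀ + m) ^ p := by
    intro m
    have h : x (i₀ + m) * s (i₀ + m + 1) = s (i₀ + m) - g (i₀ + m) := by rw [hsx (i₀ + m)]; ring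
    calc s (i₀ + m + 1) ^ p * x (i₀ + m) ^ p = (x (i₀ + m) * s (i₀ + m + 1)) ^ p := by ring
      _ = (s (i₀ + m) - g (i₀ + m)) ^ p := by rw [h]
      _ = s (i₀ + m) ^ p - g (i₀ + m) ^ p := by rw [sub_pow_char]
  have hisol : ∀ m, ∃ N : ℕ, Ideal.span (Set.range (X : Fin d → MvPowerSeries (Fin d) κ)) ^ N ≤
      Ideal.span (Set.range fun l : Fin d =>
        MvPowerSeries.pderiv l (φ m ⟨s (i₀ + m) ^ p, hsp (i₀ + m)⟩)) := by
    intro m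
    haveI := hregi (i₀ + m)
    obtain ⟨hf, N, hN⟩ := hcon (i₀ + m) (Nat.le_add_right _ _)
    have hrad : Ideal.comap (Subring.inclusion (hRO (i₀ + m))) (maximalIdeal O) ≤
        (Ideal.span (Set.range fun δ : Derivation ℤ (R (i₀ + m)) (R (i₀ + m)) =>
          δ ⟨s (i₀ + m) ^ p, hsp (i₀ + m)⟩)).radical := fun y hy =>
      ⟨N, hN y ((ValuationSubring.valuation_lt_one_iff O _).mp (Ideal.mem_comap.mp hy))⟩
    have hfgc : (Ideal.comap (Subring.inclusion (hRO (i₀ + m))) (maximalIdeal O)).FG := IsNoetherian.noetherian _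
    obtain ⟨N', hN'⟩ := Ideal.exists_pow_le_of_le_radical_of_fg hrad hfgc
    exact ⟨N', hI O p (R (i₀ + m)) (hRO _) (hdomi _) (hperf _) d (hch m).2.2.1 (φ m) (hch m).2.1
      ⟨s (i₀ + m) ^ p, hsp (i₀ + m)⟩ N' hN'⟩
  have hrun := infRun_of_charts (p := p) (hS := hS) (hd := hd0) (S := fun m => R (i₀ + m))
    (hle := fun m => (hq (i₀ + m)).le) (φ := φ) (j := j) (τ := τ) (w := w)
    (hw := fun m => (hch m).2.2.2.2.1) (htrans := fun m => (hch m).2.2.2.1)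
    (f := fun m => s (i₀ + m) ^ p) (g := fun m => g (i₀ + m)) (x := fun m => x (i₀ + m))
    (hf := fun m => hsp (i₀ + m)) (hg := fun m => hg (i₀ + m)) (hx := fun m => (hx (i₀ + m)).1)
    (hφx := fun m => (hch m).2.2.2.2.2) (hrel := hrel) (hisol := hisol)
  exact not_infRun hT p hp d hd0 κ _ j τ hrun

end Leaf

end Summit.ResolutionOfSingularities.ResolutionOfSingularities.Theorems.SwitchingDichotomy.Core4Dictionary

end
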